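import Mathlib.RingTheory.PowerSeries.Inverse
import Mathlib.RingTheory.HahnSeries.PowerSeries
import Literature.NumberTheory.Transcendental.AyoubRelative
import Literature.NumberTheory.Transcendental.LandauDefectLatticeTate
import HarnessLib

/-!
# Tate families are `t`-free rational elements of Ayoub's `𝒪†_alg`

Topic `Literature/NumberTheory/Transcendental`; the bridge between `LandauDefectLatticeTate.lean`
(Tate families `F = P/Q`, `P, Q ∈ k[z][ϖ]`, `Q(z,0) = c₀ ≠ 0`, and their Landau data) and
`AyoubRelative.lean` (Ayoub's `𝒪 = k[z, t^{±1}]`, `𝒪((ϖ))`, `𝒪†_alg`, term-by-term integration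
`intLaurent`), for the definition request `defn-LandauDefectLattice` (route InverseLandau).

* `TateFamily₁.toLaurent T : LaurentSeries (O k)` — the `ϖ`-EXPANSION of `F = P/Q`: the cube
  variable `z` is sent to Ayoub's `z₀ = mono (single 0 1, 0)`, `Q ≡ c₀ (mod ϖ)` is inverted in
  `𝒪[[ϖ]]` (`PowerSeries.invOfUnit`), and `P · Q⁻¹ ∈ 𝒪[[ϖ]] ⊂ 𝒪((ϖ))`.
* `TateFamily₁.polyToLaurent_Q_mul_toLaurent` (proved): `Q · F = P` in `𝒪((ϖ))`.
* **`TateFamily₁.toLaurent_mem_Odagger`** (proved): `F ∈ 𝒪†_alg` — it is annihilated by the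
  non-zero linear polynomial `Q Y - P ∈ 𝒪[ϖ][Y]` (Ayoub, Notation 1.6).

So a Tate family `T` yields both an element `T.toLaurent` of `AyoubRel.Odagger k` (to which
`AyoubRel.intLaurent` and `ayoub_relativeKZ_revisited` apply) and its Landau data
`T.landauSet / T.incidenceMatrix / T.defectLattice` (`LandauDefectLatticeTate.lean`).

## References
* J. Ayoub, *La version relative de la conjecture des périodes de Kontsevich–Zagier revisitée*,
  §1.2, Notation 1.6 (`AyoubRelKZRevisited`).
-/

noncomputable section

open Polynomial

namespace Literature.NumberTheory.Transcendental.AyoubRel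

namespace TateFamily₁

variable {k : Type} [Field k] (T : TateFamily₁ k)

/-- Ayoub's first cube variable `z₀ ∈ 𝒪 = k[z, t^{±1}]`. [cite: AyoubRelKZRevisited, §1.2] -/
def zVar (k : Type) [Field k] : O k := mono k (Finsupp.single 0 1, 0)

/-- `k[z] → 𝒪`, `z ↦ z₀`. [folklore] -/
def polyToO (k : Type) [Field k] : Polynomial k →ₐ[k] O k := Polynomial.aeval (zVar k)

/-- `k[z][ϖ] → 𝒪[ϖ]`, coefficientwise. [folklore] -/
def toOPoly (R : Polynomial (Polynomial k)) : Polynomial (O k) := R.map (polyToO k).toRingHom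

/-- `k[z][ϖ] → 𝒪[[ϖ]]`. [folklore] -/
def toOPowerSeries (R : Polynomial (Polynomial k)) : PowerSeries (O k) :=
  (toOPoly R : PowerSeries (O k))

/-- The structure map `k → 𝒪` is injective (`𝒪` is a non-trivial `k`-algebra). [folklore] -/
theorem algebraMap_O_injective (k : Type) [Field k] : Function.Injective (algebraMap k (O k)) :=
  (algebraMap k (O k)).injective

/-- The constant `c₀ = Q(z, 0)` as a unit of `𝒪`. [folklore] -/
def unitC₀ : (O k)ˣ :=
  Units.map (algebraMap k (O k) : k →* O k) (Units.mk0 T.c₀ T.c₀_ne_zero)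

/-- The `ϖ⁰`-coefficient of `Q` in `𝒪[ϖ]` is the constant `c₀`. [folklore] -/
theorem coeff_toOPoly_Q_zero : (toOPoly T.Q).coeff 0 = algebraMap k (O k) T.c₀ := by
  rw [toOPoly, Polynomial.coeff_map, T.coeff_Q_zero]
  simp [polyToO]

/-- Hence the constant coefficient of `Q ∈ 𝒪[[ϖ]]` is the unit `c₀`. [folklore] -/
theorem constantCoeff_toOPowerSeries_Q :
    PowerSeries.constantCoeff (toOPowerSeries T.Q) = (T.unitC₀ : O k) := by
  rw [toOPowerSeries, Polynomial.constantCoeff_coe, coeff_toOPoly_Q_zero]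
  rfl

/-- `Q ≠ 0` in `𝒪[ϖ]`. [folklore] -/
theorem toOPoly_Q_ne_zero : toOPoly T.Q ≠ 0 := fun h => by
  have h0 := T.coeff_toOPoly_Q_zero
  rw [h, Polynomial.coeff_zero] at h0
  exact T.c₀_ne_zero (algebraMap_O_injective k (by rw [map_zero]; exact h0.symm))

/-- **The `ϖ`-expansion of a Tate family**: `F = P · Q⁻¹ ∈ 𝒪[[ϖ]] ⊂ 𝒪((ϖ))`, where `Q` (with unit
constant coefficient `c₀`) is inverted as a power series in `ϖ`.
[cite: AyoubRelKZRevisited, §1.2] -/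
def toLaurent : LaurentSeries (O k) :=
  HahnSeries.ofPowerSeries ℤ (O k)
    (toOPowerSeries T.P * PowerSeries.invOfUnit (toOPowerSeries T.Q) T.unitC₀)

/-- Ayoub's `𝒪[ϖ] → 𝒪((ϖ))` (`polyToLaurent`) is the composite `𝒪[ϖ] ⊂ 𝒪[[ϖ]] ⊂ 𝒪((ϖ))`.
[folklore] -/
theorem polyToLaurent_eq_ofPowerSeries (R : Polynomial (O k)) :
    polyToLaurent k R = HahnSeries.ofPowerSeries ℤ (O k) (R : PowerSeries (O k)) := by
  have : (polyToLaurent k).toRingHom =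
      (HahnSeries.ofPowerSeries ℤ (O k)).comp Polynomial.coeToPowerSeries.ringHom := by
    refine Polynomial.ringHom_ext (fun a => ?_) ?_
    · rw [RingHom.comp_apply, Polynomial.coeToPowerSeries.ringHom_apply, Polynomial.coe_C,
        HahnSeries.ofPowerSeries_C]
      show polyToLaurent k (C a) = HahnSeries.C a
      rw [polyToLaurent, Polynomial.aeval_C, HahnSeries.algebraMap_apply',
        PowerSeries.algebraMap_apply, Algebra.algebraMap_self, RingHom.id_apply,
        HahnSeries.ofPowerSeries_C]
    · rw [RingHom.comp_apply, Polynomial.coeToPowerSeries.ringHom_apply, Polynomial.coe_X,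
        HahnSeries.ofPowerSeries_X]
      show polyToLaurent k X = HahnSeries.single 1 1
      rw [polyToLaurent, Polynomial.aeval_X]
  exact congr_fun (congr_arg DFunLike.coe this) R

/-- **`Q · F = P` in `𝒪((ϖ))`.** [folklore] -/
theorem polyToLaurent_Q_mul_toLaurent :
    polyToLaurent k (toOPoly T.Q) * T.toLaurent = polyToLaurent k (toOPoly T.P) := by
  rw [polyToLaurent_eq_ofPowerSeries, polyToLaurent_eq_ofPowerSeries, toLaurent, ← map_mul,
    ← mul_assoc, mul_comm (↑(toOPoly T.Q) : PowerSeries (O k)), mul_assoc]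
  change HahnSeries.ofPowerSeries ℤ (O k) (toOPowerSeries T.P *
      (toOPowerSeries T.Q * PowerSeries.invOfUnit (toOPowerSeries T.Q) T.unitC₀)) =
    HahnSeries.ofPowerSeries ℤ (O k) (toOPowerSeries T.P)
  rw [PowerSeries.mul_invOfUnit _ _ T.constantCoeff_toOPowerSeries_Q, mul_one]

/-- **A Tate family is an element of Ayoub's `𝒪†_alg`**: its `ϖ`-expansion is annihilated by the
non-zero polynomial `Q · Y - P ∈ 𝒪[ϖ][Y]`. [cite: AyoubRelKZRevisited, Notation 1.6] -/
theorem toLaurent_mem_Odagger : T.toLaurent ∈ Odagger k := by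
  refine ⟨Polynomial.C (toOPoly T.Q) * X - Polynomial.C (toOPoly T.P), ?_, ?_⟩
  · intro h
    have h1 := congr_arg (fun R => Polynomial.coeff R 1) h
    simp only [Polynomial.coeff_sub, Polynomial.coeff_C_mul, Polynomial.coeff_X_one, mul_one,
      Polynomial.coeff_C, if_neg (one_ne_zero), sub_zero, Polynomial.coeff_zero] at h1
    exact T.toOPoly_Q_ne_zero h1
  · rw [Polynomial.eval₂_sub, Polynomial.eval₂_mul, Polynomial.eval₂_C, Polynomial.eval₂_X,
      Polynomial.eval₂_C]
    change polyToLaurent k (toOPoly T.Q) * T.toLaurent - polyToLaurent k (toOPoly T.P) = 0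
    rw [polyToLaurent_Q_mul_toLaurent, sub_self]

/-- The `ϖ`-expansion has no polar part: it is supported in exponents `≥ 0`. [folklore] -/
theorem toLaurent_coeff_of_neg {m : ℤ} (hm : m < 0) : T.toLaurent.coeff m = 0 := by
  rw [toLaurent, HahnSeries.ofPowerSeries_apply]
  refine HahnSeries.embDomain_notin_range ?_
  rintro ⟨i, hi⟩
  have : (i : ℤ) = m := by simpa using hi
  omega

end TateFamily₁

end Literature.NumberTheory.Transcendental.AyoubRel
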